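import Summits.BirchSwinnertonDyer.BirchSwinnertonDyer.Theorems.PrintCf2RubinValueTwoFourTermCFTImage
import HarnessLib

/-!
# The four-term sequence of class field theory at a finite level, V: exactness at `X_S(K)` in annihilator
# form — a sub-layer `E ⊆ L` is everywhere unramified iff it is fixed by the image of the principal units `U_S`

Cell `bsd-print-cf2` (HOME `run/shared/lean/pub/bsd-print-cf2/`), seat `bsd-line-cf2c-w6` g3, brick §4(d)
«four-term sequence `0 → Ē_∞ → U_v → 𝒳^{(v)} → A_∞ → 0` (CFT over `𝔎_∞L′`)» of LEAD memo
`Cruxes/SplitBadTwoRankOneOfFacts/RULING-B23-g13.md` §4, crux of record stmt-BirchSwinnertonDyer-24033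
`PrintCf2RubinValueTwo.TwoVariableMainConjAtSplitTwoQuad`. Fifth file of the finite-level four-term CFT brick
(`…FourTermCFTPrelim`, `…Kernel`, `…UnitsDie`, `…Image`): the right end `X_S(K) → A(K) → 0` in the form the
(e)-sockets' binder `range u = Ann(S_A)` takes — ANNIHILATORS. For a finite abelian `L ⊆ K̄` and a sub-layer
`E ⊆ L` (`IntermediateField.restrict hEL`, its group `(restrict hEL).fixingSubgroup ≤ G(L|K)`), with the tree's
Lang XI §4 Thm. 4 for sub-layers (`isUnramifiedIn_iff_map_localUnits_le_fixingSubgroup`: `E` unramified at `w`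
iff `ψ_{L|K}(⟨𝒪_wˣ⟩_w)` fixes `E`):

* `artinIdeleMap_localUnits_mem_fixingSubgroup_of_isUnramifiedIn` (⟹ on one unit) and
  `isUnramifiedIn_of_le_of_isUnramifiedIn` (a sub-layer of a layer unramified at `w` is unramified at `w`);
* `isUnramifiedIn_of_le_of_forall_principal_localUnits_mem_fixingSubgroup`: for `[L:K] = p^n` and `w ∣ p`,
  PRINCIPAL units suffice (`𝒪_wˣ/U¹_w` of order `q_w − 1` prime to `p`, Bezout in `G(L|K)`);
* `forall_isUnramifiedIn_iff_forall_principal_localUnits_mem_fixingSubgroup` (**exactness at `X_S(K)`**): for `L` of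
  `p`-power degree unramified outside `S ⊆ {w ∣ p}` and any `E ⊆ L`: `E` is everywhere unramified iff
  `ψ_{L|K}(⟨u⟩_w)` fixes `E` for all `w ∈ S`, `u ∈ U¹_w` — the characters of `G(L|K) = X_S(K)|_L` that are everywhere
  unramified (`S_A|_L`) are exactly those killing the image of `U_S`: «`im(U_S) ^⊥ = S_A`», i.e.
  `Gal(L/L_nr) = ⟨ψ_L(U_S)⟩` with `L_nr` the maximal everywhere-unramified sub-layer (de Shalit III.1.3 `X/im U = A`).

Plumbing: `exists_units_map_subtype_eq_of_valued_eq_one`, `valued_units_map_subtype` (local units of valuation `1`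
are units of `𝒪_w`). No `sorry`, no definition, no named fact; Theses-free. No summit statement is proved; BSD is not
advanced here.

## References
* [LangANT1994] S. Lang, *Algebraic Number Theory*, Ch. XI §4 Thm. 4 and the remark following its proof.
* [CasselsFrohlichANT1967] J. Tate, Ch. VII §5.3. [deShalit1987] Ch. III §1.3. [Washington1997] Thm. 13.4.
-/

noncomputable section

set_option linter.dupNamespace false -- D-0017: single-problem summit, `…BirchSwinnertonDyer.BirchSwinnertonDyer…` repeats a namespace by design
set_option autoImplicit false

open NumberField IsDedekindDomain IsDedekindDomain.HeightOneSpectrum WithZero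
open scoped nonZeroDivisors Topology
open Literature.NumberTheory Literature.NumberTheory.NumberFields Literature.NumberTheory.GaloisRepresentations

namespace Summit.BirchSwinnertonDyer.BirchSwinnertonDyer.Theorems.PrintCf2.FourTermCFT

/-! ### The annihilator form: sub-layers fixed by the image of `U_S` -/

section Annihilator

variable {K : Type} [Field K] [NumberField K]

/-- A local unit of `K_w` (valuation `1`) is the image of a unit of `𝒪_w`. [folklore] -/
theorem exists_units_map_subtype_eq_of_valued_eq_one {w : HeightOneSpectrum (𝓞 K)} {u : (w.adicCompletion K)ˣ}
    (hu : Valued.v (u : w.adicCompletion K) = 1) :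
    ∃ u₀ : (w.adicCompletionIntegers K)ˣ,
      Units.map ((w.adicCompletionIntegers K).subtype : w.adicCompletionIntegers K →* w.adicCompletion K) u₀ = u := by
  have hu' : Valued.v ((u⁻¹ : (w.adicCompletion K)ˣ) : w.adicCompletion K) = 1 := by
    rw [Units.val_inv_eq_inv_val, map_inv₀, hu, inv_one]
  exact ⟨⟨⟨(u : w.adicCompletion K), hu.le⟩, ⟨((u⁻¹ : (w.adicCompletion K)ˣ) : w.adicCompletion K), hu'.le⟩,
    Subtype.ext (Units.mul_inv u), Subtype.ext (Units.inv_mul u)⟩, Units.ext rfl⟩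

/-- The image of a unit of `𝒪_w` in `K_wˣ` has valuation `1`. [folklore] -/
theorem valued_units_map_subtype {w : HeightOneSpectrum (𝓞 K)} (u₀ : (w.adicCompletionIntegers K)ˣ) :
    Valued.v ((Units.map ((w.adicCompletionIntegers K).subtype :
      w.adicCompletionIntegers K →* w.adicCompletion K) u₀ : (w.adicCompletion K)ˣ) : w.adicCompletion K) = 1 := by
  change Valued.v ((u₀ : w.adicCompletionIntegers K) : w.adicCompletion K) = 1
  exact Valuation.Integers.one_of_isUnit (Valuation.integer.integers _) u₀.isUnit

variable (L : IntermediateField K (AlgebraicClosure K)) [FiniteDimensional K L] [IsAbelianGalois K L] [NumberField L]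

/-- **A sub-layer `E ⊆ L` unramified at `w` is fixed by `ψ_{L|K}(⟨𝒪_wˣ⟩_w)`** (Lang XI §4 Thm. 4 for the subextensions
of a class field, the tree's `isUnramifiedIn_iff_map_localUnits_le_fixingSubgroup`, read on one local unit).
[cite: LangANT1994, Ch. XI §4 Thm. 4] [cite: CasselsFrohlichANT1967, Ch. VII §5.3] -/
theorem artinIdeleMap_localUnits_mem_fixingSubgroup_of_isUnramifiedIn {E : IntermediateField K (AlgebraicClosure K)}
    (hEL : E ≤ L) {w : HeightOneSpectrum (𝓞 K)} (hE : Algebra.IsUnramifiedIn (𝓞 E) w.asIdeal)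
    (u : (w.adicCompletion K)ˣ) (hu : Valued.v (u : w.adicCompletion K) = 1) :
    artinIdeleMap L artinReciprocity_character_holds (localUnits w u) ∈
      (IntermediateField.restrict hEL).fixingSubgroup := by
  obtain ⟨u₀, rfl⟩ := exists_units_map_subtype_eq_of_valued_eq_one hu
  exact (isUnramifiedIn_iff_map_localUnits_le_fixingSubgroup L hEL).1 hE ⟨_, ⟨u₀, rfl⟩, rfl⟩

/-- **A sub-layer of an unramified layer is unramified**: `E ⊆ L` with `L` unramified at `w` ⟹ `E` unramified at `w`
(`ψ_{L|K}(⟨𝒪_wˣ⟩_w) = 1` fixes everything). [cite: LangANT1994, Ch. XI §4 Thm. 4] -/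
theorem isUnramifiedIn_of_le_of_isUnramifiedIn {E : IntermediateField K (AlgebraicClosure K)} (hEL : E ≤ L)
    {w : HeightOneSpectrum (𝓞 K)} (hL : Algebra.IsUnramifiedIn (𝓞 L) w.asIdeal) :
    Algebra.IsUnramifiedIn (𝓞 E) w.asIdeal := by
  rw [isUnramifiedIn_iff_map_localUnits_le_fixingSubgroup L hEL]
  rintro _ ⟨_, ⟨u₀, rfl⟩, rfl⟩
  rw [MonoidHom.comp_apply, (isUnramifiedIn_iff_forall_artinIdeleMap_localUnits_eq_one L).1 hL _
    (valued_units_map_subtype u₀)]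
  exact Subgroup.one_mem _

/-- **Principal units decide, in a `p`-power layer** (the `U¹_w`-refinement for sub-layers): for `L` of `p`-power
degree, `E ⊆ L`, `w ∣ p`: if `ψ_{L|K}(⟨u⟩_w)` fixes `E` for every PRINCIPAL unit `u ∈ U¹_w`, then `E` is unramified
at `w` (`𝒪_wˣ/U¹_w` has order `q_w − 1` prime to `p`; Bezout in `G(L|K)`). [cite: LangANT1994, Ch. XI §4 Thm. 4]
[cite: deShalit1987, III.1.3] -/
theorem isUnramifiedIn_of_le_of_forall_principal_localUnits_mem_fixingSubgroup {p : ℕ} [hp : Fact p.Prime]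
    (hdeg : ∃ n, Module.finrank K L = p ^ n) {E : IntermediateField K (AlgebraicClosure K)} (hEL : E ≤ L)
    (w : HeightOneSpectrum (𝓞 K)) (hw : ((p : ℕ) : 𝓞 K) ∈ w.asIdeal)
    (h : ∀ u : (w.adicCompletion K)ˣ, Valued.v ((u : w.adicCompletion K) - 1) < 1 →
      artinIdeleMap L artinReciprocity_character_holds (localUnits w u) ∈
        (IntermediateField.restrict hEL).fixingSubgroup) :
    Algebra.IsUnramifiedIn (𝓞 E) w.asIdeal := by
  classical
  rw [isUnramifiedIn_iff_map_localUnits_le_fixingSubgroup L hEL]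
  rintro _ ⟨_, ⟨u₀, rfl⟩, rfl⟩
  rw [MonoidHom.comp_apply]
  set u := Units.map ((w.adicCompletionIntegers K).subtype :
    w.adicCompletionIntegers K →* w.adicCompletion K) u₀ with hudef
  have hu : Valued.v (u : w.adicCompletion K) = 1 := valued_units_map_subtype u₀
  haveI : Finite (IsLocalRing.ResidueField (w.adicCompletionIntegers K)) :=
    Automorphic.finite_residueField_adicCompletion K w
  letI : Fintype (IsLocalRing.ResidueField (w.adicCompletionIntegers K)) := Fintype.ofFinite _
  obtain ⟨n, hn⟩ := hdeg
  have h1 : artinIdeleMap L artinReciprocity_character_holds (localUnits w u) ^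
      (Fintype.card (IsLocalRing.ResidueField (w.adicCompletionIntegers K)) - 1) ∈
        (IntermediateField.restrict hEL).fixingSubgroup := by
    rw [← map_pow, ← map_pow]
    refine h _ ?_
    rw [Units.val_pow_eq_pow_val]
    exact valued_pow_card_residueField_sub_one_sub_one_lt w u hu
  have h2 : artinIdeleMap L artinReciprocity_character_holds (localUnits w u) ^ p ^ n ∈
      (IntermediateField.restrict hEL).fixingSubgroup := by
    rw [← hn, ← IsGalois.card_aut_eq_finrank, pow_card_eq_one']
    exact Subgroup.one_mem _
  refine mem_of_pow_mem_of_coprime _ (Nat.Coprime.pow_right n ?_) h1 h2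
  exact (Nat.Prime.coprime_iff_not_dvd hp.out).2 (not_dvd_card_residueField_sub_one w hw) |>.symm

/-- **EXACTNESS AT `X_S(K)` AT A FINITE LEVEL, annihilator form** («`im(U_S → G(L|K)) = Gal(L/L_nr)`», `L_nr` the
maximal everywhere-unramified sub-layer; de Shalit III.1.3 `X/im U = A`): for `L ⊆ K̄` finite abelian of `p`-power
degree unramified outside `S ⊆ {w ∣ p}` and ANY sub-layer `E ⊆ L`: `E` is unramified everywhere iff `E` is fixed by
`ψ_{L|K}(⟨u⟩_w)` for all `w ∈ S` and all principal units `u ∈ U¹_w` — i.e. the characters of `G(L|K)` that are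
everywhere unramified are exactly those killing the image of `U_S`. [cite: deShalit1987, III.1.3]
[cite: LangANT1994, Ch. XI §4 Thm. 4 and the remark following it] [cite: Washington1997, Thm. 13.4] -/
theorem forall_isUnramifiedIn_iff_forall_principal_localUnits_mem_fixingSubgroup {p : ℕ} [Fact p.Prime]
    (S : Finset (HeightOneSpectrum (𝓞 K))) (hS : ∀ w ∈ S, ((p : ℕ) : 𝓞 K) ∈ w.asIdeal)
    (hdeg : ∃ n, Module.finrank K L = p ^ n)
    (hunr : ∀ w : HeightOneSpectrum (𝓞 K), w ∉ S → Algebra.IsUnramifiedIn (𝓞 L) w.asIdeal)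
    {E : IntermediateField K (AlgebraicClosure K)} (hEL : E ≤ L) :
    (∀ w : HeightOneSpectrum (𝓞 K), Algebra.IsUnramifiedIn (𝓞 E) w.asIdeal) ↔
      ∀ w ∈ S, ∀ u : (w.adicCompletion K)ˣ, Valued.v ((u : w.adicCompletion K) - 1) < 1 →
        artinIdeleMap L artinReciprocity_character_holds (localUnits w u) ∈
          (IntermediateField.restrict hEL).fixingSubgroup := by
  constructor
  · intro hall w _ u hu
    refine artinIdeleMap_localUnits_mem_fixingSubgroup_of_isUnramifiedIn L hEL (hall w) u ?_
    have := Valuation.map_one_add_of_lt Valued.v hu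
    rwa [add_sub_cancel] at this
  · intro h w
    by_cases hw : w ∈ S
    · exact isUnramifiedIn_of_le_of_forall_principal_localUnits_mem_fixingSubgroup L hdeg hEL w (hS w hw) (h w hw)
    · exact isUnramifiedIn_of_le_of_isUnramifiedIn L hEL (hunr w hw)

end Annihilator

end Summit.BirchSwinnertonDyer.BirchSwinnertonDyer.Theorems.PrintCf2.FourTermCFT
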